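import Mathlib
import Summits.Ventures.PercRepro2.Defs
import Summits.Ventures.PercRepro2.Harris
import Summits.Ventures.PercRepro2.Graph
import Summits.Ventures.PercRepro2.Events
import Summits.Ventures.PercRepro2.Induced
import Summits.Ventures.PercRepro2.SameClusterAvoid
import Summits.Ventures.PercRepro2.BHKAvoid
import Summits.Ventures.PercRepro2.CCTRootEdge
import Summits.Ventures.PercRepro2.CCTAvoidedEdge
import Summits.Ventures.PercRepro2.OneRootDropMono

/-!
# With two roots, the conditional lean `E_ν[σ_b | v ∉ C₁]` falls with every edge at `v`
(blind cell PercRepro2, mine-c g28; `conjectures/MINE-C.md` §37.13)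

Roots `a₁, a₂`, a mark `b`, a vertex `v`; `ν = P(· | a₁ ↮ a₂)`, `σ_b = 1[b ∈ C₁] − 1[b ∈ C₂]`,
`N = {a₁ ↮ a₂, a₁ ↮ v}` (the event `Q ∩ {v ∉ C₁}`), and an edge `e = {v, y}` at `v` of weight `t`:

  `clean p = (P_p(N, b ∈ C₁) − P_p(N, b ∈ C₂)) / P_p(N)  (= E_ν[σ_b | v ∉ C₁])`

is non-increasing in `t` wherever `P_t(N) > 0`.  Proof: condition on the status of `e`.  With `e`
open, `N` forces `a₁ ↮ y` (in `G − e`) and then the cluster of `a₁` is unchanged by `e`, so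
`P₁(N) = P₀(N, a₁ ↮ y)`, `P₁(N, b ∈ C₁) = P₀(N, a₁ ↮ y, b ∈ C₁)`, while `b ∈ C₂` can only be gained:
`P₁(N, b ∈ C₂) ≥ P₀(N, a₁ ↮ y, b ∈ C₂)`.  BHK06 Thm 1.3 with the avoided set `{a₂, v}`
(`bhk_same_cluster_events_avoid`) lowers `P(b ∈ C₁)` under the extra condition `y ∉ C₁`, BHK06 Thm 1.4
with the avoided set (`bhk_cross_cluster_avoid`) raises `P(b ∈ C₂)` under it; the conditional lean
at `t` is the mediant of the `e`-closed and `e`-open values with the weight on the second growing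
with `t`.  The one-root case (`a₂` isolated) is `OneRootDrop.drop_mono`.
-/

namespace Summit.Ventures.PercRepro2

namespace TwoRootLean

variable {V : Type*} {E : Type*} [Fintype V] [DecidableEq V] [Fintype E] [DecidableEq E]
  {R : Type*} [Field R] [LinearOrder R] [IsStrictOrderedRing R]

/-- The event `N = {a₁ ↮ a₂, a₁ ↮ v}` (`= Q ∩ {v ∉ C₁}`). -/
def NEvent (ends : E → Sym2 V) (a₁ a₂ v : V) : Set (Config E) := avoidAll ends a₁ {a₂, v}

/-- The conditional lean `E_ν[σ_b | v ∉ C₁] = (P(N, b ∈ C₁) − P(N, b ∈ C₂)) / P(N)`. -/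
noncomputable def clean (p : E → R) (ends : E → Sym2 V) (a₁ a₂ b v : V) : R :=
  (prob p (NEvent ends a₁ a₂ v ∩ connEvent ends a₁ b) -
      prob p (NEvent ends a₁ a₂ v ∩ connEvent ends a₂ b)) / prob p (NEvent ends a₁ a₂ v)

section Pinned

variable {ends : E → Sym2 V} {e : E} {v y : V}

omit [Fintype V] [Fintype E] in
/-- With `e = {v, y}` open, `N` holds iff (with `e` closed) `N` and `a₁ ↮ y`. -/
lemma update_true_mem_N_iff (hends : ends e = s(v, y)) (ω : Config E) (a₁ a₂ : V) :
    Function.update ω e true ∈ NEvent ends a₁ a₂ v ↔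
      Function.update ω e false ∈ NEvent ends a₁ a₂ v ∧
        Function.update ω e false ∈ avoidAll ends a₁ {y} := by
  have hv := OneRootDrop.update_true_mem_avoid_iff hends ω a₁
  simp only [NEvent, avoidAll, Set.mem_setOf_eq, Finset.mem_singleton, forall_eq,
    Finset.mem_insert, forall_eq_or_imp] at hv ⊢
  constructor
  · rintro ⟨h2, hvv⟩
    have h := hv.1 hvv
    have hcl : cluster ends (Function.update ω e true) a₁ =
        cluster ends (Function.update ω e false) a₁ :=
      CCT.cluster_update_true_eq_of_not_touch ends hends ω a₁
        (by rw [mem_cluster]; exact h.1) (by rw [mem_cluster]; exact h.2)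
    refine ⟨⟨?_, h.1⟩, h.2⟩
    rw [← mem_cluster, ← hcl, mem_cluster]
    exact h2
  · rintro ⟨⟨h2, hvv⟩, hy⟩
    have hcl : cluster ends (Function.update ω e true) a₁ =
        cluster ends (Function.update ω e false) a₁ :=
      CCT.cluster_update_true_eq_of_not_touch ends hends ω a₁
        (by rw [mem_cluster]; exact hvv) (by rw [mem_cluster]; exact hy)
    refine ⟨?_, hv.2 ⟨hvv, hy⟩⟩
    rw [← mem_cluster, hcl, mem_cluster]
    exact h2

omit [Fintype V] [Fintype E] in
/-- With `e = {v, y}` open, `N ∧ b ∈ C₁` iff (with `e` closed) `N ∧ a₁ ↮ y ∧ b ∈ C₁`. -/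
lemma update_true_mem_N_conn_iff (hends : ends e = s(v, y)) (ω : Config E) (a₁ a₂ b : V) :
    Function.update ω e true ∈ NEvent ends a₁ a₂ v ∩ connEvent ends a₁ b ↔
      Function.update ω e false ∈
        NEvent ends a₁ a₂ v ∩ avoidAll ends a₁ {y} ∩ connEvent ends a₁ b := by
  have hN := update_true_mem_N_iff hends ω a₁ a₂
  constructor
  · rintro ⟨hn, hb⟩
    have h := hN.1 hn
    have h' := h.1
    simp only [NEvent, avoidAll, Set.mem_setOf_eq, Finset.mem_insert, Finset.mem_singleton,
      forall_eq_or_imp, forall_eq] at h'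
    have hy' := h.2
    simp only [avoidAll, Set.mem_setOf_eq, Finset.mem_singleton, forall_eq] at hy'
    have hcl : cluster ends (Function.update ω e true) a₁ =
        cluster ends (Function.update ω e false) a₁ :=
      CCT.cluster_update_true_eq_of_not_touch ends hends ω a₁
        (by rw [mem_cluster]; exact h'.2) (by rw [mem_cluster]; exact hy')
    refine ⟨h, ?_⟩
    rw [mem_connEvent, ← mem_cluster, ← hcl, mem_cluster]
    exact hb
  · rintro ⟨⟨hn, hy⟩, hb⟩
    have h' := hn
    simp only [NEvent, avoidAll, Set.mem_setOf_eq, Finset.mem_insert, Finset.mem_singleton,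
      forall_eq_or_imp, forall_eq] at h'
    have hy' := hy
    simp only [avoidAll, Set.mem_setOf_eq, Finset.mem_singleton, forall_eq] at hy'
    have hcl : cluster ends (Function.update ω e true) a₁ =
        cluster ends (Function.update ω e false) a₁ :=
      CCT.cluster_update_true_eq_of_not_touch ends hends ω a₁
        (by rw [mem_cluster]; exact h'.2) (by rw [mem_cluster]; exact hy')
    refine ⟨hN.2 ⟨hn, hy⟩, ?_⟩
    rw [mem_connEvent, ← mem_cluster, hcl, mem_cluster]
    exact hb

variable (p : E → R)

omit [Fintype V] [LinearOrder R] [IsStrictOrderedRing R] in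
/-- `P₁(N) = P₀(N, a₁ ↮ y)`. -/
lemma prob_one_N (hends : ends e = s(v, y)) (a₁ a₂ : V) :
    prob (Function.update p e 1) (NEvent ends a₁ a₂ v) =
      prob (Function.update p e 0) (NEvent ends a₁ a₂ v ∩ avoidAll ends a₁ {y}) := by
  rw [CCT.prob_update_one_eq, CCT.prob_update_zero_eq]
  congr 1
  ext ω
  simp only [Set.mem_setOf_eq, Set.mem_inter_iff]
  exact update_true_mem_N_iff hends ω a₁ a₂

omit [Fintype V] [LinearOrder R] [IsStrictOrderedRing R] in
/-- `P₁(N, b ∈ C₁) = P₀(N, a₁ ↮ y, b ∈ C₁)`. -/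
lemma prob_one_N_conn (hends : ends e = s(v, y)) (a₁ a₂ b : V) :
    prob (Function.update p e 1) (NEvent ends a₁ a₂ v ∩ connEvent ends a₁ b) =
      prob (Function.update p e 0)
        (NEvent ends a₁ a₂ v ∩ avoidAll ends a₁ {y} ∩ connEvent ends a₁ b) := by
  rw [CCT.prob_update_one_eq, CCT.prob_update_zero_eq]
  congr 1
  ext ω
  simp only [Set.mem_setOf_eq]
  exact update_true_mem_N_conn_iff hends ω a₁ a₂ b

omit [Fintype V] in
/-- `P₀(N, a₁ ↮ y, b ∈ C₂) ≤ P₁(N, b ∈ C₂)`: opening `e` keeps `N ∩ {a₁ ↮ y}` inside `N` and can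
only help `a₂ ↔ b`. -/
lemma prob_zero_N_conn2_le (hp : IsProbVec p) (hends : ends e = s(v, y)) (a₁ a₂ b : V) :
    prob (Function.update p e 0)
        (NEvent ends a₁ a₂ v ∩ avoidAll ends a₁ {y} ∩ connEvent ends a₂ b) ≤
      prob (Function.update p e 1) (NEvent ends a₁ a₂ v ∩ connEvent ends a₂ b) := by
  rw [CCT.prob_update_one_eq, CCT.prob_update_zero_eq]
  refine prob_mono hp fun ω hω => ?_
  simp only [Set.mem_setOf_eq, Set.mem_inter_iff] at hω ⊢
  refine ⟨(update_true_mem_N_iff hends ω a₁ a₂).2 ⟨hω.1.1, hω.1.2⟩, ?_⟩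
  simp only [mem_connEvent] at hω ⊢
  exact conn_mono (update_false_le_update_true ω e) hω.2

end Pinned

section BHK

variable (p : E → R) (ends : E → Sym2 V) (a₁ a₂ b y v : V)

omit [Fintype V] [DecidableEq V] [Fintype E] [DecidableEq E] in
/-- `{a₁ ↮ y} = {a₁ ↔ y}ᶜ`. -/
lemma avoid_eq_compl : avoidAll ends a₁ {y} = (connEvent ends a₁ y)ᶜ := by
  ext ω
  simp only [avoidAll, Set.mem_setOf_eq, Finset.mem_singleton, forall_eq, Set.mem_compl_iff,
    mem_connEvent]

/-- **BHK06 1.3 with `{a₂, v}` avoided, complement form**: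
`P(N, a₁ ↮ y, b ∈ C₁) · P(N) ≤ P(N, b ∈ C₁) · P(N, a₁ ↮ y)`. -/
lemma bhk13_complement (hp : IsProbVec p) :
    prob p (NEvent ends a₁ a₂ v ∩ avoidAll ends a₁ {y} ∩ connEvent ends a₁ b) *
        prob p (NEvent ends a₁ a₂ v) ≤
      prob p (NEvent ends a₁ a₂ v ∩ connEvent ends a₁ b) *
        prob p (NEvent ends a₁ a₂ v ∩ avoidAll ends a₁ {y}) := by
  have hU : IsUpperSet {S : Set V | b ∈ S} := fun _ _ hST h => hST h
  have hY : IsUpperSet {S : Set V | y ∈ S} := fun _ _ hST h => hST h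
  have key := bhk_same_cluster_events_avoid p hp ends a₁ ({a₂, v} : Finset V) hU hY
  have e1 : clusterInEvent ends a₁ {S : Set V | b ∈ S} = connEvent ends a₁ b := by
    ext ω; simp only [mem_clusterInEvent, Set.mem_setOf_eq, mem_cluster, mem_connEvent]
  have e2 : clusterInEvent ends a₁ {S : Set V | y ∈ S} = connEvent ends a₁ y := by
    ext ω; simp only [mem_clusterInEvent, Set.mem_setOf_eq, mem_cluster, mem_connEvent]
  have e3 : clusterInEvent ends a₁ ({S : Set V | b ∈ S} ∩ {S : Set V | y ∈ S}) =
      connEvent ends a₁ b ∩ connEvent ends a₁ y := by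
    ext ω
    simp only [mem_clusterInEvent, Set.mem_inter_iff, Set.mem_setOf_eq, mem_cluster, mem_connEvent]
  rw [e1, e2, e3] at key
  rw [avoid_eq_compl]
  set N := NEvent ends a₁ a₂ v with hN
  set B := connEvent ends a₁ b with hB
  set Y := connEvent ends a₁ y with hYd
  have hNdef : avoidAll ends a₁ {a₂, v} = N := rfl
  rw [hNdef] at key
  have s1 := prob_inter_add_prob_inter_compl p (N ∩ B) Y
  have s2 := prob_inter_add_prob_inter_compl p N Y
  have k1 : B ∩ N = N ∩ B := Set.inter_comm _ _
  have k2 : Y ∩ N = N ∩ Y := Set.inter_comm _ _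
  have k3 : B ∩ Y ∩ N = N ∩ B ∩ Y := by
    ext ω; simp only [Set.mem_inter_iff]; tauto
  have k4 : N ∩ Yᶜ ∩ B = N ∩ B ∩ Yᶜ := by
    ext ω; simp only [Set.mem_inter_iff, Set.mem_compl_iff]; tauto
  rw [k1, k2, k3] at key
  rw [k4]
  nlinarith [key, s1, s2, prob_nonneg hp (N ∩ B), prob_nonneg hp N, prob_nonneg hp (N ∩ B ∩ Y),
    prob_nonneg hp (N ∩ Y), prob_nonneg hp (N ∩ B ∩ Yᶜ), prob_nonneg hp (N ∩ Yᶜ)]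

/-- **BHK06 1.4 with `{a₂, v}` avoided, complement form**:
`P(N, b ∈ C₂) · P(N, a₁ ↮ y) ≤ P(N, a₁ ↮ y, b ∈ C₂) · P(N)`. -/
lemma bhk14_complement (hp : IsProbVec p) :
    prob p (NEvent ends a₁ a₂ v ∩ connEvent ends a₂ b) *
        prob p (NEvent ends a₁ a₂ v ∩ avoidAll ends a₁ {y}) ≤
      prob p (NEvent ends a₁ a₂ v ∩ avoidAll ends a₁ {y} ∩ connEvent ends a₂ b) *
        prob p (NEvent ends a₁ a₂ v) := by
  have hU : IsUpperSet {S : Set V | y ∈ S} := fun _ _ hST h => hST h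
  have hB : IsUpperSet {S : Set V | b ∈ S} := fun _ _ hST h => hST h
  have key := bhk_cross_cluster_avoid p hp ends a₁ a₂ (X := ({a₂, v} : Finset V))
    (Finset.mem_insert_self a₂ {v}) hU hB
  have e1 : clusterInEvent ends a₁ {S : Set V | y ∈ S} = connEvent ends a₁ y := by
    ext ω; simp only [mem_clusterInEvent, Set.mem_setOf_eq, mem_cluster, mem_connEvent]
  have e2 : clusterInEvent ends a₂ {S : Set V | b ∈ S} = connEvent ends a₂ b := by
    ext ω; simp only [mem_clusterInEvent, Set.mem_setOf_eq, mem_cluster, mem_connEvent]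
  rw [e1, e2] at key
  rw [avoid_eq_compl]
  set N := NEvent ends a₁ a₂ v with hN
  set B₂ := connEvent ends a₂ b with hB2
  set Y := connEvent ends a₁ y with hYd
  have hNdef : avoidAll ends a₁ {a₂, v} = N := rfl
  rw [hNdef] at key
  have s1 := prob_inter_add_prob_inter_compl p (N ∩ B₂) Y
  have s2 := prob_inter_add_prob_inter_compl p N Y
  have k1 : Y ∩ B₂ ∩ N = N ∩ B₂ ∩ Y := by
    ext ω; simp only [Set.mem_inter_iff]; tauto
  have k2 : Y ∩ N = N ∩ Y := Set.inter_comm _ _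
  have k3 : B₂ ∩ N = N ∩ B₂ := Set.inter_comm _ _
  have k4 : N ∩ Yᶜ ∩ B₂ = N ∩ B₂ ∩ Yᶜ := by
    ext ω; simp only [Set.mem_inter_iff, Set.mem_compl_iff]; tauto
  rw [k1, k2, k3] at key
  rw [k4]
  nlinarith [key, s1, s2, prob_nonneg hp (N ∩ B₂), prob_nonneg hp N,
    prob_nonneg hp (N ∩ B₂ ∩ Y), prob_nonneg hp (N ∩ Y), prob_nonneg hp (N ∩ B₂ ∩ Yᶜ),
    prob_nonneg hp (N ∩ Yᶜ)]

end BHK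

section Main

variable (p : E → R) (ends : E → Sym2 V) {e : E} {v y : V}

/-- **The two-root conditional-lean theorem**: `clean p[e↦t] = E_ν[σ_b | v ∉ C₁]` is non-increasing
in the weight `t` of an edge `e = {v, y}` at `v`, wherever `P_t(N) > 0` (for `s ≤ t`; the bounds
`0 ≤ s`, `t ≤ 1` are not needed for the algebra). -/
theorem clean_antitone (hp : IsProbVec p) (hends : ends e = s(v, y)) (a₁ a₂ b : V) {s t : R}
    (hst : s ≤ t) (hpos : 0 < prob (Function.update p e t) (NEvent ends a₁ a₂ v)) :
    clean (Function.update p e t) ends a₁ a₂ b v ≤ clean (Function.update p e s) ends a₁ a₂ b v := by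
  have hp₀ : IsProbVec (Function.update p e 0) := hp.update e le_rfl zero_le_one
  unfold clean
  set N := NEvent ends a₁ a₂ v with hN
  set Ry := avoidAll ends a₁ {y} with hRy
  set B₁ := connEvent ends a₁ b with hB1
  set B₂ := connEvent ends a₂ b with hB2
  set ε := prob (Function.update p e 0) N with hε
  set ε' := prob (Function.update p e 0) (N ∩ Ry) with hε'
  set β₁ := prob (Function.update p e 0) (N ∩ B₁) with hβ₁
  set β₁' := prob (Function.update p e 0) (N ∩ Ry ∩ B₁) with hβ₁'
  set β₂ := prob (Function.update p e 0) (N ∩ B₂) with hβ₂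
  set β₂' := prob (Function.update p e 0) (N ∩ Ry ∩ B₂) with hβ₂'
  set β₂'' := prob (Function.update p e 1) (N ∩ B₂) with hβ₂''
  have h1 : prob (Function.update p e 1) N = ε' := prob_one_N p hends a₁ a₂
  have h2 : prob (Function.update p e 1) (N ∩ B₁) = β₁' := prob_one_N_conn p hends a₁ a₂ b
  have h3 : β₂' ≤ β₂'' := prob_zero_N_conn2_le p hp hends a₁ a₂ b
  have hb13 : β₁' * ε ≤ β₁ * ε' := bhk13_complement (Function.update p e 0) ends a₁ a₂ b y v hp₀
  have hb14 : β₂ * ε' ≤ β₂' * ε := bhk14_complement (Function.update p e 0) ends a₁ a₂ b y v hp₀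
  have hε0 : 0 ≤ ε := prob_nonneg hp₀ _
  have hε'ε : ε' ≤ ε := prob_mono hp₀ Set.inter_subset_left
  have hε'0 : 0 ≤ ε' := prob_nonneg hp₀ _
  rw [OneRootDrop.prob_update_eq_pin p t (N ∩ B₁), OneRootDrop.prob_update_eq_pin p t (N ∩ B₂),
    OneRootDrop.prob_update_eq_pin p t N, OneRootDrop.prob_update_eq_pin p s (N ∩ B₁),
    OneRootDrop.prob_update_eq_pin p s (N ∩ B₂), OneRootDrop.prob_update_eq_pin p s N, h1, h2]
  rw [OneRootDrop.prob_update_eq_pin p t N, h1] at hpos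
  set Dt := t * ε' + (1 - t) * ε with hDt
  set Ds := s * ε' + (1 - s) * ε with hDs
  have hDsDt : Dt ≤ Ds := by
    have : 0 ≤ (t - s) * (ε - ε') := mul_nonneg (sub_nonneg.2 hst) (sub_nonneg.2 hε'ε)
    have : Ds - Dt = (t - s) * (ε - ε') := by rw [hDs, hDt]; ring
    linarith
  have hDspos : 0 < Ds := lt_of_lt_of_le hpos hDsDt
  rw [div_le_div_iff₀ hpos hDspos]
  -- `(t β₁' + (1−t) β₁ − t β₂'' − (1−t) β₂) Ds ≤ (s β₁' + (1−s) β₁ − s β₂'' − (1−s) β₂) Dt`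
  -- ⟺ `(t − s) [(β₁' − β₂'') ε − (β₁ − β₂) ε'] ≤ 0`
  have hid : (t * β₁' + (1 - t) * β₁ - (t * β₂'' + (1 - t) * β₂)) * Ds -
      (s * β₁' + (1 - s) * β₁ - (s * β₂'' + (1 - s) * β₂)) * Dt =
      (t - s) * ((β₁' - β₂'') * ε - (β₁ - β₂) * ε') := by
    rw [hDs, hDt]; ring
  have hkey : (β₁' - β₂'') * ε ≤ (β₁ - β₂) * ε' := by
    have : β₂'' * ε ≥ β₂' * ε := mul_le_mul_of_nonneg_right h3 hε0
    nlinarith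
  nlinarith [mul_nonneg (sub_nonneg.2 hst) (sub_nonneg.2 hkey)]

end Main

end TwoRootLean

end Summit.Ventures.PercRepro2
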